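import Mathlib.RingTheory.LaurentSeries
import Mathlib.RingTheory.PowerSeries.Derivative
import HarnessLib

/-!
# The derivative of formal Laurent series is a derivation (Leibniz rule), extending the power-series derivative

`Literature/RingTheory/PowerSeries/LaurentSeriesDerivation.lean` — everything PROVED, no
definition. Mathlib defines `LaurentSeries.derivative R : R⸨X⸩ →ₗ[R] R⸨X⸩` (via Hasse
derivatives) but records no product rule for it. Here, over a commutative ring `R`:

* `derivative_mul` — the Leibniz rule `(fg)′ = f′ g + f g′`;
* `derivative_coe_powerSeries`, `derivative_iterate_coe_powerSeries`, `derivative_coe_polynomial`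
  — compatibility with `PowerSeries.derivative` and `Polynomial.derivative` along the coercions
  `R[X] → R⟦X⟧ → R⸨X⸩`;
* `derivative_single_mul`, `derivative_single_one_one`, `laurent_coeff_derivative`,
  `coeff_coe_powerSeries_int` — the coefficient and monomial formulas used.

This makes `R⸨X⸩ = Frac R⟦X⟧` (for a field `R`) usable as a differential field extension of
`R(X)`/`R⟦X⟧` in formal arguments about linear differential operators (solutions with poles at
a point versus power-series solutions), e.g. in
`Literature/NumberTheory/Transcendental/FischlerRivoalCorollary1OfAndre.lean`.
-/

noncomputable section

open HahnSeries LaurentSeries PowerSeries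

namespace Literature.RingTheory.PowerSeries


variable {R : Type*} [CommRing R]

/-- Coefficients of a power series seen as a Laurent series, at an arbitrary integer index. [folklore] -/
theorem coeff_coe_powerSeries_int (x : R⟦X⟧) (n : ℤ) :
    HahnSeries.coeff (x : R⸨X⸩) n = if 0 ≤ n then PowerSeries.coeff n.toNat x else 0 := by
  split_ifs with h
  · rw [← LaurentSeries.coeff_coe_powerSeries, Int.toNat_of_nonneg h]
  · rw [ofPowerSeries_apply, embDomain_notin_range]
    intro hn
    simp only [Nat.castOrderEmbedding_apply, Set.mem_range] at hn
    obtain ⟨m, rfl⟩ := hn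
    exact h (Int.natCast_nonneg m)

/-- Coefficients of the derivative of a Laurent series: `[Xⁿ] f′ = (n+1)·[Xⁿ⁺¹] f`. [folklore] -/
theorem laurent_coeff_derivative (f : R⸨X⸩) (n : ℤ) :
    (LaurentSeries.derivative R f).coeff n = (n + 1) • f.coeff (n + 1) := by
  simp only [derivative_apply, hasseDeriv_coeff, Nat.cast_one, Ring.choose_one_right]

/-- **The Laurent derivative extends the formal derivative of power series.** PROVED. [folklore] -/
theorem derivative_coe_powerSeries (x : R⟦X⟧) :
    LaurentSeries.derivative R (x : R⸨X⸩) = ((PowerSeries.derivative R x : R⟦X⟧) : R⸨X⸩) := by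
  ext n
  rw [laurent_coeff_derivative, coeff_coe_powerSeries_int, coeff_coe_powerSeries_int]
  by_cases h : 0 ≤ n
  · obtain ⟨m, rfl⟩ := Int.eq_ofNat_of_zero_le h
    have h1 : (0 : ℤ) ≤ (m : ℤ) + 1 := by omega
    have h2 : ((m : ℤ) + 1).toNat = m + 1 := by omega
    rw [if_pos h1, if_pos h, _root_.PowerSeries.coeff_derivative, h2, Int.toNat_natCast, zsmul_eq_mul,
      mul_comm]
    push_cast
    ring
  · rw [if_neg h]
    by_cases h1 : 0 ≤ n + 1
    · have hn : n = -1 := by omega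
      subst hn
      simp
    · rw [if_neg h1, smul_zero]

/-- Derivative of `c Xⁿ · g` (Leibniz rule against a monomial). [folklore] -/
theorem derivative_single_mul (n : ℤ) (c : R) (g : R⸨X⸩) :
    LaurentSeries.derivative R (single n c * g) =
      single (n - 1) (n • c) * g + single n c * LaurentSeries.derivative R g := by
  ext m
  rw [laurent_coeff_derivative, HahnSeries.coeff_add, coeff_single_mul, coeff_single_mul,
    coeff_single_mul, laurent_coeff_derivative]
  have : m + 1 - n = m - n + 1 := by ring
  rw [this, show m - (n - 1) = m - n + 1 by ring, zsmul_eq_mul, zsmul_eq_mul, zsmul_eq_mul]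
  push_cast
  ring

/-- **Leibniz rule for the derivative of formal Laurent series** over a commutative ring:
`(fg)′ = f′g + fg′` for Mathlib's `LaurentSeries.derivative` (defined there through Hasse
derivatives, without this rule). Proof: write `f = Xᵃ F`, `g = Xᵇ G` with power series `F, G`
and use the power-series Leibniz rule. PROVED. [folklore] -/
theorem derivative_mul (f g : R⸨X⸩) :
    LaurentSeries.derivative R (f * g) =
      LaurentSeries.derivative R f * g + f * LaurentSeries.derivative R g := by
  -- write `f = X^a F`, `g = X^b G` with power series `F`, `G`
  set a := f.order
  set b := g.order
  set F := f.powerSeriesPart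
  set G := g.powerSeriesPart
  have hf : (single a (1 : R) : R⸨X⸩) * (F : R⸨X⸩) = f := single_order_mul_powerSeriesPart f
  have hg : (single b (1 : R) : R⸨X⸩) * (G : R⸨X⸩) = g := single_order_mul_powerSeriesPart g
  rw [← hf, ← hg]
  have hFG : ((F * G : R⟦X⟧) : R⸨X⸩) = (F : R⸨X⸩) * (G : R⸨X⸩) := _root_.PowerSeries.coe_mul F G
  -- both sides in normal form
  have lhs : (single a (1 : R) : R⸨X⸩) * (F : R⸨X⸩) * ((single b (1 : R) : R⸨X⸩) * (G : R⸨X⸩)) =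
      single (a + b) (1 : R) * ((F * G : R⟦X⟧) : R⸨X⸩) := by
    rw [hFG, mul_mul_mul_comm, single_mul_single, mul_one]
  rw [lhs, derivative_single_mul, derivative_coe_powerSeries, derivative_single_mul,
    derivative_single_mul, derivative_coe_powerSeries, derivative_coe_powerSeries,
    (PowerSeries.derivative R).leibniz]
  simp only [smul_eq_mul, map_add, map_mul]
  -- normalise products of singles
  have e1 : ∀ (x y : ℤ) (r s : R) (P Q : R⸨X⸩),
      single x r * P * (single y s * Q) = single (x + y) (r * s) * (P * Q) := by
    intro x y r s P Q
    rw [mul_mul_mul_comm, single_mul_single]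
  simp only [add_mul, mul_add]
  rw [e1, e1, e1, e1]
  simp only [zsmul_eq_mul, mul_one, one_mul]
  rw [show a - 1 + b = a + b - 1 by ring, show a + (b - 1) = a + b - 1 by ring]
  have hsingle : (single (a + b - 1) (((a + b : ℤ) : R)) : R⸨X⸩) =
      single (a + b - 1) ((a : ℤ) : R) + single (a + b - 1) ((b : ℤ) : R) := by
    rw [← single_add]; push_cast; rfl
  push_cast at hsingle ⊢
  rw [hsingle]
  ring

/-- Iterated derivatives are compatible with the coercion from power series. [folklore] -/
theorem derivative_iterate_coe_powerSeries (x : R⟦X⟧) (k : ℕ) :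
    (LaurentSeries.derivative R)^[k] (x : R⸨X⸩) =
      (((PowerSeries.derivative R)^[k] x : R⟦X⟧) : R⸨X⸩) := by
  induction k generalizing x with
  | zero => rfl
  | succ k ih =>
    rw [Function.iterate_succ_apply, Function.iterate_succ_apply, derivative_coe_powerSeries, ih]

/-- The Laurent derivative of (the image of) a polynomial is (the image of) its derivative. [folklore] -/
theorem derivative_coe_polynomial (p : Polynomial R) :
    LaurentSeries.derivative R ((p : R⟦X⟧) : R⸨X⸩) =
      (((Polynomial.derivative p : Polynomial R) : R⟦X⟧) : R⸨X⸩) := by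
  rw [derivative_coe_powerSeries, _root_.PowerSeries.derivative_coe]

/-- The derivative of the uniformizer: `X′ = 1` in `R⸨X⸩`. [folklore] -/
theorem derivative_single_one_one :
    LaurentSeries.derivative R (single 1 (1 : R) : R⸨X⸩) = 1 := by
  ext n
  rw [laurent_coeff_derivative, HahnSeries.coeff_single, HahnSeries.coeff_one]
  by_cases hn : n = 0
  · subst hn; simp
  · rw [if_neg (by omega), if_neg hn, smul_zero]

end Literature.RingTheory.PowerSeries

end
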